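import Mathlib
import HarnessLib
import Literature.AlgebraicGeometry.Resolution.ComponentGluing

/-!
# Component glue for Cohen–Macaulay models (crux `FrobeniusLadder.FInjectiveMacaulayfication`, line `Sketch`)

Stub `stub_cmGlue` of the skeleton `Sketch` for crux stmt-ResolutionOfSingularities-15315 (route
`FrobeniusLadder`, rung 2). The crux asks, for every reduced separated `k`-scheme of finite type, for a
proper birational model whose stalks are Cohen–Macaulay domains (every system of parameters — `d = dim`
elements generating an ideal with maximal radical — is a weakly regular sequence) with F-injectivity
on top. This file proves the purely geometric glue of the ladder: the statement for INTEGRAL `X`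
(Macaulayfication with integral Cohen–Macaulay source, the neighbouring stub `stub_kawasakiIntegral`,
here only the ANTECEDENT of an implication) implies the statement for REDUCED `X` with a source all of
whose stalks are Cohen–Macaulay domains.

Proof (folklore; Cossart–Piltant 2019, proof of Prop. 4.6, Step 1, for resolutions): `X` is
Noetherian, hence has finitely many irreducible components `Z`; each `Z` with its reduced closed
subscheme structure `(vanishingIdeal Z).subscheme` is integral, separated and of finite type over `k`,
so it has a model `X_Z' → X_Z` by hypothesis; the disjoint union `∐ X_Z' → X` is proper and
birational (`ComponentGluing.isProper_coprodDesc`, `ComponentGluing.isBirational_coprodDesc_of_closed_cover`,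
induction over the components exactly as in `ComponentGluing.hasResolution_subscheme_biUnion`), and its
stalks are stalks of the pieces (the coprojections are open immersions), to which the Cohen–Macaulay
domain clause transports along the stalk isomorphisms (`cmDomain_of_ringEquiv`).

The glue is stated for an ARBITRARY predicate `P` on schemes which holds for empty schemes and is
stable under binary disjoint unions (`exists_model_of_closed_cover`, `exists_model_of_iso`,
`exists_model_subscheme_biUnion`, `exists_model_of_irreducibleComponents`); the stub instantiates `P`
with the Cohen–Macaulay domain clause on stalks (`cmDomain_coprod`).
-/

-- single-problem summit: the doubled namespace component is forced
set_option linter.dupNamespace false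

noncomputable section

open AlgebraicGeometry CategoryTheory CategoryTheory.Limits TopologicalSpace
  Literature.AlgebraicGeometry.Resolution

namespace Summit.ResolutionOfSingularities.ResolutionOfSingularities.Theorems.FInjectiveMacaulayfication

universe u

/-! ## Transport of the Cohen–Macaulay domain clause along ring isomorphisms -/

/-- The clause "`A` is a domain and every system of parameters of `A` (`d = dim A` elements generating
an ideal with maximal radical) is a weakly regular sequence" transports along a ring isomorphism
`e : A ≃+* B`: pull the tuple back along `e.symm`, apply the clause in `A`, and push weak regularity
forward with `AddEquiv.isWeaklyRegular_congr`. [folklore] -/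
theorem cmDomain_of_ringEquiv {A B : Type u} [CommRing A] [CommRing B] (e : A ≃+* B)
    (h : IsDomain A ∧ ∀ d : ℕ, ringKrullDim A = d → ∀ s : Fin d → A,
      (Ideal.span (Set.range s)).radical.IsMaximal →
        RingTheory.Sequence.IsWeaklyRegular A (List.ofFn s)) :
    IsDomain B ∧ ∀ d : ℕ, ringKrullDim B = d → ∀ s : Fin d → B,
      (Ideal.span (Set.range s)).radical.IsMaximal →
        RingTheory.Sequence.IsWeaklyRegular B (List.ofFn s) := by
  obtain ⟨hdom, hcm⟩ := h
  refine ⟨MulEquiv.isDomain A e.symm.toMulEquiv, ?_⟩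
  intro d hd s hmax
  have hdA : ringKrullDim A = d := by rw [ringKrullDim_eq_of_ringEquiv e, hd]
  have hI : Ideal.span (Set.range (e.symm ∘ s)) = (Ideal.span (Set.range s)).comap e := by
    rw [Set.range_comp, ← Ideal.map_span, Ideal.map_symm]
  have hmaxA : (Ideal.span (Set.range (e.symm ∘ s))).radical.IsMaximal := by
    rw [hI, ← Ideal.comap_radical]
    exact Ideal.comap_isMaximal_of_equiv e
  have hreg := hcm d hdA (e.symm ∘ s) hmaxA
  have hmap : List.ofFn s = (List.ofFn (e.symm ∘ s)).map e := by
    rw [List.map_ofFn]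
    congr 1
    funext i
    simp
  rw [hmap]
  refine (AddEquiv.isWeaklyRegular_congr (e := e.toAddEquiv) ?_).mp hreg
  refine List.forall₂_map_right_iff.mpr (List.forall₂_same.mpr fun r _ x => ?_)
  change e (r * x) = e r * e x
  exact map_mul e r x

/-! ## Stalks of a disjoint union -/

/-- The Cohen–Macaulay domain clause on all stalks passes to binary disjoint unions: every point of
`U ⨿ V` comes from `U` or `V` through the open immersions `coprod.inl`, `coprod.inr`, which induce
isomorphisms on stalks. [folklore] -/
theorem cmDomain_coprod {U V : Scheme.{u}}
    (hU : ∀ x : U, IsDomain (U.presheaf.stalk x) ∧ ∀ d : ℕ, ringKrullDim (U.presheaf.stalk x) = d →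
      ∀ s : Fin d → U.presheaf.stalk x, (Ideal.span (Set.range s)).radical.IsMaximal →
        RingTheory.Sequence.IsWeaklyRegular (U.presheaf.stalk x) (List.ofFn s))
    (hV : ∀ y : V, IsDomain (V.presheaf.stalk y) ∧ ∀ d : ℕ, ringKrullDim (V.presheaf.stalk y) = d →
      ∀ s : Fin d → V.presheaf.stalk y, (Ideal.span (Set.range s)).radical.IsMaximal →
        RingTheory.Sequence.IsWeaklyRegular (V.presheaf.stalk y) (List.ofFn s)) :
    ∀ z : ↥(U ⨿ V), IsDomain ((U ⨿ V).presheaf.stalk z) ∧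
      ∀ d : ℕ, ringKrullDim ((U ⨿ V).presheaf.stalk z) = d →
        ∀ s : Fin d → (U ⨿ V).presheaf.stalk z, (Ideal.span (Set.range s)).radical.IsMaximal →
          RingTheory.Sequence.IsWeaklyRegular ((U ⨿ V).presheaf.stalk z) (List.ofFn s) := by
  intro z
  rcases coprod_point_cases z with ⟨x, rfl⟩ | ⟨y, rfl⟩
  · exact cmDomain_of_ringEquiv
      (asIso ((coprod.inl : U ⟶ U ⨿ V).stalkMap x)).commRingCatIsoToRingEquiv.symm (hU x)
  · exact cmDomain_of_ringEquiv
      (asIso ((coprod.inr : V ⟶ U ⨿ V).stalkMap y)).commRingCatIsoToRingEquiv.symm (hV y)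

/-! ## Proper birational models with a prescribed property of the source: the glue -/

/-- **Gluing models along a closed cover.** Let `P` be a property of schemes stable under binary
disjoint unions. If the reduced scheme `X` is covered by closed subschemes `C`, `D` with mutually dense
complements and `C`, `D` have proper birational models with property `P`, so does `X`: the disjoint
union `C' ⨿ D' → X` is proper (`ComponentGluing.isProper_coprodDesc`) and birational
(`ComponentGluing.isBirational_coprodDesc_of_closed_cover`).
[cite: CossartPiltant2019, proof of Prop. 4.6, Step 1 (arXiv v1: Prop. 4.4)] -/
theorem exists_model_of_closed_cover (P : Scheme.{u} → Prop)
    (hPc : ∀ U V : Scheme.{u}, P U → P V → P (U ⨿ V)) {C D X : Scheme.{u}} [IsReduced X]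
    (ι₁ : C ⟶ X) (ι₂ : D ⟶ X) [IsClosedImmersion ι₁] [IsClosedImmersion ι₂]
    (hcov : Set.range ι₁ ∪ Set.range ι₂ = Set.univ)
    (hd₁ : Dense (ι₁ ⁻¹' (Set.range ι₂)ᶜ)) (hd₂ : Dense (ι₂ ⁻¹' (Set.range ι₁)ᶜ))
    (h₁ : ∃ (C' : Scheme.{u}) (ρ : C' ⟶ C), IsProper ρ ∧ IsBirational ρ ∧ P C')
    (h₂ : ∃ (D' : Scheme.{u}) (ρ : D' ⟶ D), IsProper ρ ∧ IsBirational ρ ∧ P D') :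
    ∃ (Y : Scheme.{u}) (π : Y ⟶ X), IsProper π ∧ IsBirational π ∧ P Y := by
  obtain ⟨C', ρ₁, hprop₁, hbir₁, hP₁⟩ := h₁
  obtain ⟨D', ρ₂, hprop₂, hbir₂, hP₂⟩ := h₂
  haveI := hprop₁
  haveI := hprop₂
  exact ⟨C' ⨿ D', coprod.desc (ρ₁ ≫ ι₁) (ρ₂ ≫ ι₂), ComponentGluing.isProper_coprodDesc _ _,
    ComponentGluing.isBirational_coprodDesc_of_closed_cover ι₁ ι₂ hcov hd₁ hd₂ hbir₁ hbir₂,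
    hPc _ _ hP₁ hP₂⟩

/-- Proper birational models with property `P` transport along isomorphisms of the target.
[folklore] -/
theorem exists_model_of_iso (P : Scheme.{u} → Prop) {X Z : Scheme.{u}} (g : X ⟶ Z) [IsIso g]
    (h : ∃ (Y : Scheme.{u}) (π : Y ⟶ X), IsProper π ∧ IsBirational π ∧ P Y) :
    ∃ (Y : Scheme.{u}) (π : Y ⟶ Z), IsProper π ∧ IsBirational π ∧ P Y := by
  obtain ⟨Y, π, hprop, hbir, hP⟩ := h
  haveI := hprop
  exact ⟨Y, π ≫ g, inferInstance, hbir.comp_iso g, hP⟩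

/-- The empty scheme is its own proper birational model (the identity, an isomorphism over `⊤`).
[folklore] -/
theorem exists_model_of_isEmpty (P : Scheme.{u} → Prop) (hP0 : ∀ Y : Scheme.{u}, IsEmpty Y → P Y)
    (X : Scheme.{u}) [IsEmpty X] :
    ∃ (Y : Scheme.{u}) (π : Y ⟶ X), IsProper π ∧ IsBirational π ∧ P Y := by
  refine ⟨X, 𝟙 X, inferInstance, ⟨⊤, ?_, ?_, ?_⟩, hP0 X ‹_›⟩
  · simp
  · simp
  · infer_instance

section Components

open Scheme.IdealSheafData

variable {X : Scheme.{u}}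

/-- **Models of a finite union of irreducible components** of a reduced scheme with property `P` of
the source (`P` holding for empty schemes and stable under binary disjoint unions), given such a model
of each component with its reduced (hence integral) closed-subscheme structure
`(vanishingIdeal Z).subscheme`: induction on the number of components, gluing along
`exists_model_of_closed_cover` — the proof of `ComponentGluing.hasResolution_subscheme_biUnion`
verbatim with `Scheme.HasResolution` replaced by "has a proper birational model with property `P`".
[cite: CossartPiltant2019, proof of Prop. 4.6, Step 1 (arXiv v1: Prop. 4.4)] -/
theorem exists_model_subscheme_biUnion (P : Scheme.{u} → Prop)
    (hP0 : ∀ Y : Scheme.{u}, IsEmpty Y → P Y) (hPc : ∀ U V : Scheme.{u}, P U → P V → P (U ⨿ V))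
    (hres : ∀ Z : Closeds X, (Z : Set X) ∈ irreducibleComponents X →
      ∃ (Y : Scheme.{u}) (π : Y ⟶ (vanishingIdeal Z).subscheme),
        IsProper π ∧ IsBirational π ∧ P Y)
    (S : Finset (Set X)) (hS : (S : Set (Set X)) ⊆ irreducibleComponents X) (T : Closeds X)
    (hT : (T : Set X) = ⋃ Z ∈ S, Z) :
    ∃ (Y : Scheme.{u}) (π : Y ⟶ (vanishingIdeal T).subscheme),
      IsProper π ∧ IsBirational π ∧ P Y := by
  classical
  induction S using Finset.induction_on generalizing T with
  | empty =>
    -- the subscheme is empty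
    have hT' : (T : Set X) = ∅ := by simpa using hT
    haveI : IsEmpty (vanishingIdeal T).subscheme := ⟨fun x => by
      have := ComponentGluing.mem_of_subscheme_vanishingIdeal T x
      rw [← SetLike.mem_coe, hT'] at this
      exact this⟩
    exact exists_model_of_isEmpty P hP0 _
  | insert Z S hZS ih =>
    have hZ : Z ∈ irreducibleComponents X := hS (Finset.mem_insert_self Z S)
    have hS' : (S : Set (Set X)) ⊆ irreducibleComponents X :=
      fun W hW => hS (Finset.mem_insert_of_mem hW)
    -- the two closed pieces: `Z` and the union `T₂` of the other components
    let T₁ : Closeds X := ⟨Z, isClosed_of_mem_irreducibleComponents Z hZ⟩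
    let T₂ : Closeds X := ⟨⋃ W ∈ S, W, isClosed_biUnion_finset fun W hW =>
      isClosed_of_mem_irreducibleComponents W (hS' hW)⟩
    have hT₁₂ : (T : Set X) = (T₁ : Set X) ∪ T₂ := by
      rw [hT, Finset.set_biUnion_insert]; rfl
    have h₁T : T₁ ≤ T := by
      intro x hx; rw [← SetLike.mem_coe, hT₁₂]; exact Or.inl hx
    have h₂T : T₂ ≤ T := by
      intro x hx; rw [← SetLike.mem_coe, hT₁₂]; exact Or.inr hx
    -- `Z ⊄ T₂` and `W ⊄ Z` for `W ∈ S`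
    have hZT₂ : ¬ (Z ⊆ (T₂ : Set X)) := fun h =>
      hZS (ComponentGluing.mem_of_subset_biUnion_of_mem_irreducibleComponents hZ S hS' h)
    have hWZ : ∀ W ∈ S, ¬ (W ⊆ Z) := by
      intro W hW h
      have : W = Z := Set.Subset.antisymm h ((hS' hW).2 hZ.1 h)
      exact hZS (this ▸ hW)
    -- the pieces as closed subschemes of `X_T`
    let ι₁ := inclusion (vanishingIdeal_antimono h₁T)
    let ι₂ := inclusion (vanishingIdeal_antimono h₂T)
    haveI : IsReduced (vanishingIdeal T).subscheme :=
      ComponentGluing.isReduced_subscheme_vanishingIdeal T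
    -- model of the component `Z`: hypothesis
    have h₁ : ∃ (Y : Scheme.{u}) (π : Y ⟶ (vanishingIdeal T₁).subscheme),
        IsProper π ∧ IsBirational π ∧ P Y := hres T₁ hZ
    -- model of the rest: induction
    have h₂ := ih hS' T₂ rfl
    refine exists_model_of_closed_cover P hPc ι₁ ι₂ ?_ ?_ ?_ h₁ h₂
    · -- jointly surjective
      refine Set.eq_univ_of_forall fun y => ?_
      have hy := ComponentGluing.mem_of_subscheme_vanishingIdeal T y
      rw [← SetLike.mem_coe, hT₁₂] at hy
      rcases hy with hy | hy
      · left; rw [ComponentGluing.range_inclusion]; exact hy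
      · right; rw [ComponentGluing.range_inclusion]; exact hy
    · -- the complement of `T₂` is dense in `X_Z`
      rw [ComponentGluing.range_inclusion]
      have hopen :
          IsOpen (ι₁ ⁻¹' ((vanishingIdeal T).subschemeι ⁻¹' (T₂ : Set X))ᶜ) :=
        (T₂.2.preimage (vanishingIdeal T).subschemeι.continuous).isOpen_compl.preimage
          ι₁.continuous
      haveI : IsIntegral (vanishingIdeal T₁).subscheme :=
        ComponentGluing.isIntegral_subscheme_vanishingIdeal T₁ hZ.1
      refine hopen.dense ?_
      obtain ⟨x, hxZ, hxT₂⟩ := Set.not_subset.mp hZT₂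
      have hx : x ∈ Set.range (vanishingIdeal T₁).subschemeι := by
        rw [ComponentGluing.range_subschemeι_vanishingIdeal]; exact hxZ
      obtain ⟨c, rfl⟩ := hx
      refine ⟨c, ?_⟩
      show (vanishingIdeal T).subschemeι (ι₁ c) ∉ (T₂ : Set X)
      rw [ComponentGluing.subschemeι_inclusion_apply]
      exact hxT₂
    · -- the complement of `Z` is dense in `X_{T₂}`
      rw [ComponentGluing.range_inclusion, dense_iff_inter_open]
      intro O' hO' hO'ne
      obtain ⟨O, hO, rfl⟩ :=
        (vanishingIdeal T₂).subschemeι.isClosedEmbedding.isInducing.isOpen_iff.mp hO'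
      obtain ⟨d₀, hd₀⟩ := hO'ne
      have hd₀T : (vanishingIdeal T₂).subschemeι d₀ ∈ (T₂ : Set X) :=
        ComponentGluing.mem_of_subscheme_vanishingIdeal T₂ d₀
      obtain ⟨W, hW, hd₀W⟩ := Set.mem_iUnion₂.mp hd₀T
      have hWirr : IsPreirreducible W := (hS' hW).1.2
      obtain ⟨x, hxW, hxO, hxZ⟩ := hWirr O Zᶜ hO
        (isClosed_of_mem_irreducibleComponents Z hZ).isOpen_compl ⟨_, hd₀W, hd₀⟩
        (by
          obtain ⟨x, hxW, hxZ⟩ := Set.not_subset.mp (hWZ W hW)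
          exact ⟨x, hxW, hxZ⟩)
      have hx : x ∈ Set.range (vanishingIdeal T₂).subschemeι := by
        rw [ComponentGluing.range_subschemeι_vanishingIdeal]
        exact Set.mem_iUnion₂.mpr ⟨W, hW, hxW⟩
      obtain ⟨d, rfl⟩ := hx
      refine ⟨d, hxO, ?_⟩
      show (vanishingIdeal T).subschemeι (ι₂ d) ∉ (T₁ : Set X)
      rw [ComponentGluing.subschemeι_inclusion_apply]
      exact hxZ

/-- **Reduction to the irreducible components**: a reduced scheme with finitely many irreducible
components has a proper birational model with property `P` of the source (`P` holding for empty
schemes and stable under binary disjoint unions) as soon as each irreducible component, with its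
reduced (= integral) closed-subscheme structure, has one.
[cite: CossartPiltant2019, proof of Prop. 4.6, Step 1 (arXiv v1: Prop. 4.4)] -/
theorem exists_model_of_irreducibleComponents (P : Scheme.{u} → Prop)
    (hP0 : ∀ Y : Scheme.{u}, IsEmpty Y → P Y) (hPc : ∀ U V : Scheme.{u}, P U → P V → P (U ⨿ V))
    (X : Scheme.{u}) [IsReduced X] (hfin : (irreducibleComponents (X : Type u)).Finite)
    (hres : ∀ Z : Closeds X, (Z : Set X) ∈ irreducibleComponents X →
      ∃ (Y : Scheme.{u}) (π : Y ⟶ (vanishingIdeal Z).subscheme),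
        IsProper π ∧ IsBirational π ∧ P Y) :
    ∃ (Y : Scheme.{u}) (π : Y ⟶ X), IsProper π ∧ IsBirational π ∧ P Y := by
  classical
  have h := exists_model_subscheme_biUnion P hP0 hPc hres hfin.toFinset (by simp) ⊤ (by
    refine (Set.eq_univ_of_forall fun x => ?_).trans Set.top_eq_univ.symm |>.symm
    exact Set.mem_iUnion₂.mpr ⟨irreducibleComponent x,
      hfin.mem_toFinset.mpr (irreducibleComponent_mem_irreducibleComponents x),
      mem_irreducibleComponent⟩)
  haveI := ComponentGluing.isIso_subschemeι_vanishingIdeal_top (X := X)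
  exact exists_model_of_iso P (vanishingIdeal (⊤ : Closeds X)).subschemeι h

/-- **Reduction to integral closed subschemes over a field**: a reduced `k`-scheme `X` of finite type
has a proper birational model with property `P` of the source (`P` holding for empty schemes and
stable under binary disjoint unions) as soon as every integral closed subscheme
`(vanishingIdeal Z).subscheme ↪ X` has one (`X` is Noetherian, so it has finitely many irreducible
components). [cite: CossartPiltant2019, proof of Prop. 4.6, Step 1 (arXiv v1: Prop. 4.4)] -/
theorem exists_model_of_forall_closeds (P : Scheme.{u} → Prop)
    (hP0 : ∀ Y : Scheme.{u}, IsEmpty Y → P Y) (hPc : ∀ U V : Scheme.{u}, P U → P V → P (U ⨿ V))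
    {k : Type u} [Field k] (X : Scheme.{u}) (f : X ⟶ Spec (.of k))
    [LocallyOfFiniteType f] [QuasiCompact f] [IsReduced X]
    (h : ∀ Z : Closeds X, IsIntegral (vanishingIdeal Z).subscheme →
      ∃ (Y : Scheme.{u}) (π : Y ⟶ (vanishingIdeal Z).subscheme),
        IsProper π ∧ IsBirational π ∧ P Y) :
    ∃ (Y : Scheme.{u}) (π : Y ⟶ X), IsProper π ∧ IsBirational π ∧ P Y := by
  haveI : IsLocallyNoetherian X := LocallyOfFiniteType.isLocallyNoetherian f
  haveI : CompactSpace X := QuasiCompact.compactSpace_of_compactSpace f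
  haveI : IsNoetherian X := {}
  exact exists_model_of_irreducibleComponents P hP0 hPc X
    TopologicalSpace.NoetherianSpace.finite_irreducibleComponents
    fun Z hZ => h Z (ComponentGluing.isIntegral_subscheme_of_mem_irreducibleComponents Z hZ)

end Components

/-! ## The stub -/

/-- GLUE (Sketch `stub_cmGlue`, folklore): Macaulayfication with integral Cohen–Macaulay source for
INTEGRAL separated `k`-schemes of finite type implies, for every REDUCED separated `k`-scheme of finite
type, a proper birational model all of whose stalks are Cohen–Macaulay domains — Macaulayfy each
irreducible component with its reduced (= integral) closed-subscheme structure and take the disjoint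
union (`exists_model_of_forall_closeds` with `P` the Cohen–Macaulay domain clause on stalks, stable
under disjoint unions by `cmDomain_coprod`; stalks of an integral scheme are domains).
[cite: CossartPiltant2019, proof of Prop. 4.6, Step 1 (arXiv v1: Prop. 4.4)] -/
theorem stub_cmGlue :
    (∀ (k : Type) [Field k] (X : Scheme.{0}) (f : X ⟶ Spec (.of k)),
      IsSeparated f → LocallyOfFiniteType f → QuasiCompact f → IsIntegral X →
        ∃ (X₁ : Scheme.{0}) (π₁ : X₁ ⟶ X), IsProper π₁ ∧
          Literature.AlgebraicGeometry.Resolution.IsBirational π₁ ∧ IsIntegral X₁ ∧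
          ∀ x : X₁, ∀ d : ℕ, ringKrullDim (X₁.presheaf.stalk x) = d →
            ∀ s : Fin d → X₁.presheaf.stalk x, (Ideal.span (Set.range s)).radical.IsMaximal →
              RingTheory.Sequence.IsWeaklyRegular (X₁.presheaf.stalk x) (List.ofFn s)) →
    ∀ (k : Type) [Field k] (X : Scheme.{0}) (f : X ⟶ Spec (.of k)),
      IsSeparated f → LocallyOfFiniteType f → QuasiCompact f → IsReduced X →
        ∃ (X₁ : Scheme.{0}) (π₁ : X₁ ⟶ X), IsProper π₁ ∧
          Literature.AlgebraicGeometry.Resolution.IsBirational π₁ ∧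
          ∀ x : X₁, IsDomain (X₁.presheaf.stalk x) ∧ ∀ d : ℕ, ringKrullDim (X₁.presheaf.stalk x) = d →
            ∀ s : Fin d → X₁.presheaf.stalk x, (Ideal.span (Set.range s)).radical.IsMaximal →
              RingTheory.Sequence.IsWeaklyRegular (X₁.presheaf.stalk x) (List.ofFn s) := by
  intro hInt k _ X f hsep hft hqc hred
  refine exists_model_of_forall_closeds
    (fun Y : Scheme.{0} => ∀ y : Y, IsDomain (Y.presheaf.stalk y) ∧
      ∀ d : ℕ, ringKrullDim (Y.presheaf.stalk y) = d →
        ∀ s : Fin d → Y.presheaf.stalk y, (Ideal.span (Set.range s)).radical.IsMaximal →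
          RingTheory.Sequence.IsWeaklyRegular (Y.presheaf.stalk y) (List.ofFn s))
    (fun Y hY y => (hY.false y).elim) (fun U V hU hV => cmDomain_coprod hU hV) X f fun Z hZ => ?_
  haveI := hZ
  obtain ⟨X₁, π₁, hprop, hbir, hint, hcm⟩ :=
    hInt k _ ((Scheme.IdealSheafData.vanishingIdeal Z).subschemeι ≫ f) inferInstance inferInstance
      inferInstance hZ
  haveI := hint
  exact ⟨X₁, π₁, hprop, hbir, fun x => ⟨inferInstance, hcm x⟩⟩

end Summit.ResolutionOfSingularities.ResolutionOfSingularities.Theorems.FInjectiveMacaulayfication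

end
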